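import Mathlib

/-!
# Sharp packing bound for ordered escape ladders in `ZMod m` (mixed co-volumes)

Item `stmt-MatrixMultiplication-14308` (`FourierTwoFamiliesModP.PrimeTwoFamilies`, CKSU 2005 Conj. 4.7
with prime cyclic hosts), support file from siege attempt k8 on the registered stub
`ladder_card_mul_sqrt_le` (variation "certificate on the finite core").  The stub itself — the
uniform-co-volume bound `r · √P ≤ m` — is already in the tree as
`LadderLift.ladder_card_mul_sqrt_le` (`Theorems/FourierTwoFamiliesModPPrimeTwoFamiliesLadderPacking.lean`)
and is NOT re-declared here; this file lands the strictly sharper mixed-co-volume form it is a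
4-line corollary of (`r · √P = ∑ c, √P ≤ ∑ c, √(|X c| · |Y c|) ≤ m`).

An ORDERED ESCAPE LADDER in `ZMod m` is a family of `r` classes `(X c, Y c)`, `c : Fin r`, such that
for classes `p < q` every lower cross difference `y' - x'` (`x' ∈ X p`, `y' ∈ Y q`) differs from
every diagonal difference `y - x` (`x ∈ X c`, `y ∈ Y c`, any class `c`) — hypothesis `hL` below,
inlined verbatim from the registered stub.

## Result

`ladder_sum_sqrt_card_mul_card_le` (NO uniformity, positivity or non-emptiness hypothesis):
`∑ c, √(|X c| · |Y c|) ≤ m`.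

## Proof (certificate form)

Let `S` be the set of classes both of whose sides are non-empty (the other classes contribute `0`
to the sum).  The two maps `(c, x) ↦ x` on `S.sigma X` and `(c, y) ↦ y` on `S.sigma Y` are
INJECTIVE into `ZMod m` (`sum_card_le_of_disjoint`): a coincidence `x ∈ X p ∩ X q` with `p < q`
together with any `y ∈ Y q` is the forbidden coincidence of `hL` at `c = q` (`y - x = y - x`,
`disjoint_X_of_lt`), and symmetrically a coincidence `y ∈ Y p ∩ Y q` with any `x ∈ X p` is
forbidden at `c = p` (`disjoint_Y_of_lt`).  Hence `∑_{c ∈ S} |X c| ≤ m` and `∑_{c ∈ S} |Y c| ≤ m`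
(`Finset.card_le_card_of_injOn`, `Finset.card_sigma`), and Cauchy–Schwarz
(`Real.sum_sqrt_mul_sqrt_le`) gives `∑_{c ∈ S} √|X c| · √|Y c| ≤ √m · √m = m`.

Compared with the uniform form (AM–GM with a common co-volume `P > 0`), the sharp form is the
`ℓ¹`-of-geometric-means bound: for ladders with unequal co-volumes it saves the logarithmic loss of
dyadic pigeon-holing on the co-volume, and it needs no non-emptiness bookkeeping from the user.
Mathlib only.
-/

-- single-conjunct summit: the mandated namespace repeats `MatrixMultiplication` (summit = sub-problem).
set_option linter.dupNamespace false

namespace Summit.MatrixMultiplication.MatrixMultiplication.Theorems.PrimeTwoFamilies.LadderPackingSharp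

open Finset

/-- In an ordered escape ladder, `X p` and `X q` (`p < q`) are disjoint as soon as `Y q` is
non-empty: a common point `x` and any `y ∈ Y q` give the forbidden coincidence of `hL` at `c = q`. -/
theorem disjoint_X_of_lt {m r : ℕ} (X Y : Fin r → Finset (ZMod m))
    (hL : ∀ c p q : Fin r, p < q → ∀ x ∈ X c, ∀ y ∈ Y c, ∀ x' ∈ X p, ∀ y' ∈ Y q, y - x ≠ y' - x')
    {p q : Fin r} (hpq : p < q) (hYq : (Y q).Nonempty) : Disjoint (X p) (X q) := by
  obtain ⟨y, hy⟩ := hYq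
  exact Finset.disjoint_left.2 fun x hxp hxq => hL q p q hpq x hxq y hy x hxp y hy rfl

/-- In an ordered escape ladder, `Y p` and `Y q` (`p < q`) are disjoint as soon as `X p` is
non-empty: a common point `y` and any `x ∈ X p` give the forbidden coincidence of `hL` at `c = p`. -/
theorem disjoint_Y_of_lt {m r : ℕ} (X Y : Fin r → Finset (ZMod m))
    (hL : ∀ c p q : Fin r, p < q → ∀ x ∈ X c, ∀ y ∈ Y c, ∀ x' ∈ X p, ∀ y' ∈ Y q, y - x ≠ y' - x')
    {p q : Fin r} (hpq : p < q) (hXp : (X p).Nonempty) : Disjoint (Y p) (Y q) := by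
  obtain ⟨x, hx⟩ := hXp
  exact Finset.disjoint_left.2 fun y hyp hyq => hL p p q hpq x hx y hyp x hx y hyq rfl

/-- PACKING CERTIFICATE.  If the sets `T c`, `c ∈ S`, are pairwise disjoint subsets of `ZMod m`,
then the projection `(c, t) ↦ t` is an injection of `S.sigma T` into `ZMod m`, so
`∑_{c ∈ S} |T c| ≤ m`. -/
theorem sum_card_le_of_disjoint {m r : ℕ} [NeZero m] (S : Finset (Fin r)) (T : Fin r → Finset (ZMod m))
    (hT : ∀ p ∈ S, ∀ q ∈ S, p < q → Disjoint (T p) (T q)) : ∑ c ∈ S, (T c).card ≤ m := by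
  have hinj : Set.InjOn (fun a : (Σ _ : Fin r, ZMod m) => a.2) (S.sigma T : Set (Σ _ : Fin r, ZMod m)) := by
    rintro ⟨p, x⟩ hp ⟨q, x'⟩ hq hxx'
    simp only [Finset.coe_sigma, Set.mem_sigma_iff, Finset.mem_coe] at hp hq
    simp only at hxx'
    subst hxx'
    rcases lt_trichotomy p q with h | rfl | h
    · exact absurd hq.2 (Finset.disjoint_left.1 (hT p hp.1 q hq.1 h) hp.2)
    · rfl
    · exact absurd hp.2 (Finset.disjoint_left.1 (hT q hq.1 p hp.1 h) hq.2)
  calc ∑ c ∈ S, (T c).card = (S.sigma T).card := (Finset.card_sigma S T).symm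
    _ ≤ (Finset.univ : Finset (ZMod m)).card :=
        Finset.card_le_card_of_injOn (fun a => a.2) (fun a _ => Finset.mem_univ _) hinj
    _ = m := by rw [Finset.card_univ, ZMod.card]

/-- **Sharp packing bound for ordered escape ladders.**  For every ordered escape ladder
`(X c, Y c)_{c < r}` in `ZMod m` (hypothesis `hL`), `∑ c, √(|X c| · |Y c|) ≤ m` — with no
uniformity, positivity or non-emptiness assumption on the classes. -/
theorem ladder_sum_sqrt_card_mul_card_le {m r : ℕ} [NeZero m] (X Y : Fin r → Finset (ZMod m))
    (hL : ∀ c p q : Fin r, p < q → ∀ x ∈ X c, ∀ y ∈ Y c, ∀ x' ∈ X p, ∀ y' ∈ Y q, y - x ≠ y' - x') :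
    ∑ c, Real.sqrt (((X c).card * (Y c).card : ℕ) : ℝ) ≤ (m : ℝ) := by
  -- the classes both of whose sides are non-empty; the others contribute `0`
  set S : Finset (Fin r) := univ.filter fun c => (X c).Nonempty ∧ (Y c).Nonempty with hS
  have hmem : ∀ c, c ∈ S ↔ (X c).Nonempty ∧ (Y c).Nonempty := fun c => by simp [hS]
  have hzero : ∀ c ∈ (univ : Finset (Fin r)), c ∉ S →
      Real.sqrt (((X c).card * (Y c).card : ℕ) : ℝ) = 0 := by
    intro c _ hc
    rw [hmem, not_and_or, Finset.not_nonempty_iff_eq_empty, Finset.not_nonempty_iff_eq_empty] at hc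
    rcases hc with h | h <;> simp [h]
  rw [← Finset.sum_subset (Finset.subset_univ S) hzero]
  -- packing certificates for the two sides
  have hX : ∑ c ∈ S, ((X c).card : ℝ) ≤ m := by
    have h := sum_card_le_of_disjoint S X fun p _ q hq hpq =>
      disjoint_X_of_lt X Y hL hpq ((hmem q).1 hq).2
    exact_mod_cast h
  have hY : ∑ c ∈ S, ((Y c).card : ℝ) ≤ m := by
    have h := sum_card_le_of_disjoint S Y fun p hp q _ hpq =>
      disjoint_Y_of_lt X Y hL hpq ((hmem p).1 hp).1
    exact_mod_cast h
  -- Cauchy–Schwarz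
  calc ∑ c ∈ S, Real.sqrt (((X c).card * (Y c).card : ℕ) : ℝ)
      = ∑ c ∈ S, Real.sqrt ((X c).card : ℝ) * Real.sqrt ((Y c).card : ℝ) := by
        refine Finset.sum_congr rfl fun c _ => ?_
        rw [Nat.cast_mul, Real.sqrt_mul (Nat.cast_nonneg _)]
    _ ≤ Real.sqrt (∑ c ∈ S, ((X c).card : ℝ)) * Real.sqrt (∑ c ∈ S, ((Y c).card : ℝ)) :=
        Real.sum_sqrt_mul_sqrt_le S (fun _ => Nat.cast_nonneg _) (fun _ => Nat.cast_nonneg _)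
    _ ≤ Real.sqrt m * Real.sqrt m :=
        mul_le_mul (Real.sqrt_le_sqrt hX) (Real.sqrt_le_sqrt hY) (Real.sqrt_nonneg _)
          (Real.sqrt_nonneg _)
    _ = m := Real.mul_self_sqrt (Nat.cast_nonneg _)

end Summit.MatrixMultiplication.MatrixMultiplication.Theorems.PrimeTwoFamilies.LadderPackingSharp
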